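import Literature.AlgebraicGeometry.Modules.DetClassOfIso
import Literature.AlgebraicGeometry.Modules.LineBundleOfCocycleClass
import HarnessLib

/-!
# Descent of a line bundle along a morphism `pr : Y → S` with `𝒪_S ⥲ pr_*𝒪_Y`: a rank-one module trivial
# over the preimages of an open cover of `S` is pulled back from `S` (Görtz–Wedhorn II, Lemma 24.67)

Layer `Literature/AlgebraicGeometry/Modules`.  THEOREMS ONLY (no definition, no named fact, no instance, no
`sorry`).  For a morphism of schemes `pr : Y ⟶ S` such that `pr♯ : Γ(U, 𝒪_S) → Γ(pr⁻¹U, 𝒪_Y)` is BIJECTIVE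
for every open `U ⊆ S` (e.g. `pr = pr_T : P ×_K T → T` with `P` proper and geometrically integral over a
field `K`, the tree's `Motives.snd_app_bijective_holds`, Görtz–Wedhorn II Cor. 24.63) and an `𝒪_Y`-module
`𝓖` admitting rank-one frames `𝒪^{I_s} ≅ 𝓖|_{pr⁻¹V_s}` (`#I_s = 1`) over the preimages of an open cover
`s ↦ V_s ∋ s` of `S`:

* `isQuasicoherent_of_hasRank` — a module of constant rank is quasi-coherent (Mathlib: locally free ⇒
  quasi-coherent);
* **`exists_iso_pullback_of_frames_over_preimages`** — `∃ 𝓜 : S.Modules, HasRank 𝓜 1 ∧ 𝓜.IsQuasicoherent ∧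
  pr^*𝓜 ≅ 𝓖`.  This is Görtz–Wedhorn II, Lemma 24.67 («if `𝓛|_{f⁻¹(U_i)}` is trivial for an open cover
  `(U_i)` of `S` and `𝒪_S ⥲ f_*𝒪_X`, then `𝓛 ≅ f^*𝓜`») in MODULE form over an ARBITRARY (possibly
  non-reduced) base, complementing the divisor form `Motives.CartierDivisor.exists_linEquiv_pullback_of_
  isLocallyTrivialOver` (integral schemes) of `Motives/CartierDivisorPullbackFromBase`.  Proof in the
  tree's Čech currency: the transition functions `det T(φ_s, φ_t) ∈ Γ(pr⁻¹U, 𝒪_Y)^×` of the frame system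
  `y ↦ φ_{pr y}` (`Modules/DeterminantCocycle`, `FrameTransition.transitionDet_map/_mul/_self`) descend
  through `(pr♯)⁻¹` to a `UnitCocycle` `h` on `S` (`Scheme.Hom.naturality` + injectivity), `𝓜 := lineBundle h`
  (`Modules/LineBundleOfCocycle(Class)`: `hasRank_lineBundle`, `detClass_lineBundle`), and
  `detClass (pr^*𝓜) = pr^*[h] = [pr^*h] = [F.cocycle] = detClass 𝓖` (`detClass_pullback`,
  `CechPic.pullback_mk`, `UnitCocycle.equiv_of_eq`, `detClass_eq_mk`), whence `pr^*𝓜 ≅ 𝓖` by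
  `nonempty_iso_iff_detClass_eq` (rank one: `FrameSystem.hasRank`, `hasRank_pullback`).

Typical consumer: cohomology-and-base-change ∕ seesaw arguments over a non-reduced base, where a line
bundle on `X × S` is known to be trivial over `X × V_s` for a cover of `S` (Mumford, *Abelian Varieties*,
§5 Cor. 6, §10 p. 89).  Cell `hodgecm-mathlib`, M13 phase A, N1 socket `N1cDelta` (B-plan1 R97); generic
leaf, books 0; HC_CM is proved only modulo the printed citations until rung 0 closes.

Mathlib searched (pin v4.32): `SheafOfModules.LocalGeneratorsData.isLocallyFree` and the instance
`IsLocallyFree → IsQuasicoherent`, `Equiv.ofBijective`, `Scheme.Hom.naturality`, `Scheme.Hom.appLE` (used);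
Mathlib has no `f_*𝒪_X = 𝒪_S` descent statement for line bundles.

## References

* U. Görtz, T. Wedhorn, *Algebraic Geometry II: Cohomology of Schemes*, Springer Spektrum (2023),
  doi:10.1007/978-3-658-43031-3: Cor. 24.63 (p. 539), Lemma 24.67 (pp. 543–544). [GortzWedhorn2023]
* D. Mumford, *Abelian Varieties*, TIFR Studies in Mathematics 5 (1970): §5 Cor. 6, §10 (p. 89). [MumfordAV1970]
* R. Hartshorne, *Algebraic Geometry*, GTM 52 (1977), III Ex. 4.5 (`Pic X ≅ Ȟ¹(X, 𝒪_X^×)`). [Hartshorne1977]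
-/

noncomputable section

universe u

open CategoryTheory CategoryTheory.Limits AlgebraicGeometry TopologicalSpace Opposite

namespace Literature.AlgebraicGeometry.Modules

open Literature.AlgebraicGeometry.Motives

/-- A module of constant rank is locally free in Mathlib's sense, hence quasi-coherent.
[cite: GortzWedhorn2023, Lemma 24.67 (pp. 543–544)] -/
theorem isQuasicoherent_of_hasRank {X : Scheme.{u}} {E : X.Modules} {r : ℕ} (hE : HasRank E r) :
    E.IsQuasicoherent := by
  obtain ⟨q, hq, -⟩ := hE
  haveI := hq
  haveI : E.IsLocallyFree := q.isLocallyFree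
  infer_instance

/-- **Descent of a line bundle along `pr` with `𝒪_S ⥲ pr_*𝒪_Y`** (Görtz–Wedhorn II, Lemma 24.67, module
form, any base): if `pr♯ : Γ(U, 𝒪_S) → Γ(pr⁻¹U, 𝒪_Y)` is bijective for every open `U ⊆ S` and the
`𝒪_Y`-module `𝓖` is free of rank one over the preimages `pr⁻¹V_s` of an open cover `s ↦ V_s` of `S`, then
`𝓖 ≅ pr^*𝓜` for a rank-one (hence quasi-coherent) `𝒪_S`-module `𝓜` — the line bundle glued from the
descended transition functions `(pr♯)⁻¹(det T(φ_s, φ_t))`.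
[cite: GortzWedhorn2023, Lemma 24.67 (pp. 543–544)] [cite: MumfordAV1970, §5 Cor. 6 (seesaw)] -/
theorem exists_iso_pullback_of_frames_over_preimages {Y S : Scheme.{u}} (pr : Y ⟶ S)
    (hpr : ∀ U : S.Opens, Function.Bijective (pr.app U)) (G : Y.Modules) (V : S → S.Opens)
    (hV : ∀ s, s ∈ V s) {I : S → Type u} (ε : ∀ s, I s ≃ Fin 1)
    (φ : ∀ s, SheafOfModules.free (I s) ≅ G.over (pr ⁻¹ᵁ V s)) :
    ∃ M : S.Modules, HasRank M 1 ∧ M.IsQuasicoherent ∧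
      Nonempty ((Scheme.Modules.pullback pr).obj M ≅ G) := by
  -- the inverse of `pr♯` on sections and the transition functions of the frames
  let e : ∀ U : S.Opens, Γ(S, U) ≃ Γ(Y, pr ⁻¹ᵁ U) := fun U => Equiv.ofBijective _ (hpr U)
  let tD : ∀ (s t : S) (U : S.Opens), U ≤ V s → U ≤ V t → Γ(Y, pr ⁻¹ᵁ U) := fun s t U hs ht =>
    transitionDet (φ s) (φ t) (ε s) (ε t) (homOfLE (pr.preimage_mono hs)) (homOfLE (pr.preimage_mono ht))
  -- Step 1: the descended cocycle `h` on `S`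
  let h : UnitCocycle S :=
    { U := V
      mem := hV
      g := fun s t U hs ht => (e U).symm (tD s t U hs ht)
      map_g := fun s t U U' hs ht i => by
        apply (hpr U').1
        change (S.presheaf.map (homOfLE i).op ≫ pr.app U') _ = pr.app U' _
        rw [pr.naturality]
        change Y.presheaf.map ((Opens.map pr.base).map (homOfLE i)).op (e U ((e U).symm _)) =
          e U' ((e U').symm _)
        rw [Equiv.apply_symm_apply, Equiv.apply_symm_apply]
        exact (transitionDet_map _ _ _ _ _ _ _).trans (transitionDet_congr_hom _ _ _ _ _ _ _ _)
      g_mul := fun s t w U hs ht hw => by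
        apply (hpr U).1
        change pr.app U (_ * _) = e U ((e U).symm _)
        rw [map_mul, Equiv.apply_symm_apply]
        change e U ((e U).symm _) * e U ((e U).symm _) = _
        rw [Equiv.apply_symm_apply, Equiv.apply_symm_apply]
        exact transitionDet_mul _ _ _ _ _ _ _ _ _
      g_self := fun s U hs => by
        apply (hpr U).1
        change e U ((e U).symm _) = pr.app U 1
        rw [Equiv.apply_symm_apply, map_one]
        exact transitionDet_self _ _ _ }
  have happ : ∀ (s t : S) (U : S.Opens) (hs : U ≤ V s) (ht : U ≤ V t),
      pr.app U (h.g s t U hs ht) = tD s t U hs ht := fun s t U hs ht => (e U).apply_symm_apply _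
  -- Step 2: the frame system of `G` over the preimages (`U_y := pr⁻¹V_{pr y}`) and its cocycle class
  let F : FrameSystem G :=
    { U := fun y => pr ⁻¹ᵁ V (pr.base y)
      mem := fun y => hV (pr.base y)
      I := fun y => I (pr.base y)
      rank := fun _ => 1
      enum := fun y => ε (pr.base y)
      frame := fun y => φ (pr.base y) }
  have hF : CechPic.mk F.cocycle = CechPic.mk (UnitCocycle.pullback pr h) := by
    refine CechPic.sound (UnitCocycle.equiv_of_eq _ _ (fun y => pr ⁻¹ᵁ V (pr.base y))
      (fun y => hV (pr.base y)) (fun _ => le_rfl) (fun _ => le_rfl) fun y y' W hy hy' => ?_)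
    change pr.appLE (V (pr.base y) ⊓ V (pr.base y')) W _ (h.g _ _ _ _ _) =
      transitionDet (φ (pr.base y)) (φ (pr.base y')) (ε (pr.base y)) (ε (pr.base y')) (homOfLE hy)
        (homOfLE hy')
    rw [Scheme.Hom.appLE, CategoryTheory.comp_apply, happ]
    exact (transitionDet_map _ _ _ _ _ _ _).trans (transitionDet_congr_hom _ _ _ _ _ _ _ _)
  -- Step 3: `M := lineBundle h`; compare determinant classes
  have hG1 : HasRank G 1 := F.hasRank 1 fun _ => rfl
  have hGf : IsFiniteLocallyFree G := F.isFiniteLocallyFree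
  have hM1 := h.hasRank_lineBundle
  have hMf := h.isFiniteLocallyFree_lineBundle
  refine ⟨lineBundle h, hM1, isQuasicoherent_of_hasRank hM1, ?_⟩
  refine (nonempty_iso_iff_detClass_eq (hasRank_pullback pr hM1) hG1 (hMf.pullback pr) hGf).mpr ?_
  have h1 : detClass (hMf.pullback pr) = CechPic.mk (UnitCocycle.pullback pr h) := by
    rw [detClass_pullback pr hMf, UnitCocycle.detClass_lineBundle, CechPic.pullback_mk]
  rw [h1, detClass_eq_mk hGf F]
  exact hF.symm

end Literature.AlgebraicGeometry.Modules

end
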